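import Summits.AnomalousDissipation.AnomalousDissipation.Theorems.SawtoothPulseCascadeK1LocalisedCascadePhaseWindowsCTG
import Summits.AnomalousDissipation.AnomalousDissipation.Theorems.SawtoothPulseCascadeK1LocalisedCascadeCTEJunkNumeric
import Summits.AnomalousDissipation.AnomalousDissipation.Theorems.SawtoothPulseCascadeK1LocalisedCascadeOscJunkNumeric
import Summits.AnomalousDissipation.AnomalousDissipation.Theorems.SawtoothPulseCascadeK1LocalisedCascadeLedgerFeedChain
import Summits.AnomalousDissipation.AnomalousDissipation.Theorems.SawtoothPulseCascadeK1LocalisedCascadePhaseStep2CTGNumeric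
import Summits.AnomalousDissipation.AnomalousDissipation.Theorems.SawtoothPulseCascadeK1LocalisedCascadeTailFinalSharp

set_option linter.dupNamespace false

/-!
# K1loc — PHASE 3 OF THE K1loc′ LEDGER (`24000 → 120000 → 500000`) IN ALL-ORDERS CORNER-TRACE GRADE, AGAINST DECIMALS, AND THE CLOSER FROM PHASE 2 («CT-GEO»)

Prover lane on the crux `K1LocalisedCascade` (stmt-AnomalousDissipation-19491), route `SawtoothPulseCascade` (S-D fibre ledger,
corner-trace track; finding F-p1g9-1, memo v15).  §1–§2: the four windows of `…PhaseWindowsCTG` at phase `j = 3` (`N₃ = 8`):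
(T-H) `24000 → 120000`, (S-V) `120000 → 500000` (dyadic blocks), (O-V) above `500000`, (C-H) above `Y₃ = 41667` (blocks
`⌊Λ₀(3/2)^m⌋`), feed caps `= o₃` as in `…PhaseStep2CTGNumeric`; `(W_T, W_S, W_O, W_C) ≈ (0.0139, 0.0057, 0.0162, 0.0128)`.
§3 **the closer from the phase-2 entry data**: `…PhaseStep2CTGNumeric` ∘ this file ∘ ad-k1loc-p2's `…TailFinalSharp.k1Localised_of_phase4_sharp`
give `K1Localised P (γ² − 3)` from `S₂(800) + O₂(800) ≤ E₂`, `√O₂(800) ≤ o₂` and ONE polynomial budget in `(E₂, o₂)`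
(`k1Localised_of_phase2_ctg`), which holds e.g. at `E₂ = 0.03`, `o₂ = 0.055` with margin `0.17` (`k1Localised_of_phase2_ctg_at`).
No definitions; no statement about the crux. [cite: DEIJ2022, (1.2)–(1.3)] [cite: Grafakos2014, Prop. 3.1.2 (5), Prop. 3.2.7 (3)] [problem: turb]
-/

namespace Summit.AnomalousDissipation.AnomalousDissipation.Theorems.SawtoothPulseCascade.K1Window

open MeasureTheory Set Filter Topology UnitAddTorus Function Complex Metric
open scoped Real ENNReal
open Literature.Analysis Literature.Analysis.FunctionSpaces Literature.Analysis.FunctionSpaces.Torus Literature.Analysis.FluidPDE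
open Literature.Analysis.FluidPDE.ShearStage
open Literature.Analysis.FluidPDE.SawtoothCascade Literature.Analysis.FluidPDE.SawtoothCascade.CascadeParams
open Summit.AnomalousDissipation.AnomalousDissipation.Theorems.SawtoothPulseCascade.K1Ledger.From

section Cascade

variable (P : CascadeParams)

/-! ## §1 The four windows at phase 3 -/

set_option maxHeartbeats 4000000 in
/-- **(T-H) AT PHASE 3 AGAINST DECIMALS** (CT-GEO): `T_3(120000) ≤ S_3(24000) + (W_T + √O_3(24000))² + 10⁻⁸`, dyadic blocks from `Λ₀ = 24000` (`ℓ = 12000`, `r = 15000`, `M_b = 18`, `ε_g = 1 / 50`, order `8`). [cite: Grafakos2014, Prop. 3.1.2 (5), Prop. 3.2.7 (3)] -/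
theorem phase3_TH_ctg_le (hγ : P.γ = 8) (hδ₀ : 0 < P.δ₀) (hd : P.d = 2) (hN₀ : P.N₀ = 1) (hρN : P.ρN = 2)
    (a b : ℕ → UnitAddTorus (Fin 2) → ℝ) (has : ∀ j, IsSmooth (a j)) (h0 : a 0 = datum)
    (hb : ∀ j, b j = a j ∘ shearMap 0 1 (amp ⟨P.U j, P.U_periodic j, P.contDiff_U (P.δ_pos hδ₀ (by rw [hd]; norm_num) j)⟩ P.γ))
    (hab : ∀ j, a (j + 1) = b j ∘ shearMap 1 0 (amp ⟨P.U j, P.U_periodic j, P.contDiff_U (P.δ_pos hδ₀ (by rw [hd]; norm_num) j)⟩ P.γ))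
    (hδ₀' : P.δ₀ ≤ (2 : ℝ)⁻¹ ^ 100) :
    ∑' k : Fin 2 → ℤ, (if |k 1| < ((120000 : ℕ) : ℤ) then (1 : ℝ) else 0) * ‖mFourierCoeff (fun x => (b 3 x : ℂ)) k‖ ^ 2 ≤
      ∑' k : Fin 2 → ℤ, (if |k 0| < ((24000 : ℕ) : ℤ) then (1 : ℝ) else 0) * ‖mFourierCoeff (fun x => (a 3 x : ℂ)) k‖ ^ 2 +
      (((13866978 / 10 ^ 9 : ℝ) + (1609 / 10 ^ 14 : ℝ) + Real.sqrt (∑' k : Fin 2 → ℤ, (if ((24000 : ℕ) : ℤ) ≤ |k 0| ∧ (((1 : ℕ)) : ℤ) * |k 0| ≤ (((4 : ℕ)) : ℤ) * |k 1| then (1 : ℝ) else 0) * ‖mFourierCoeff (fun x => (a 3 x : ℂ)) k‖ ^ 2)) ^ 2 + (1 / 10 ^ 4) ^ 2) := by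
  have hδ := P.delta_le_of_le hd hδ₀.le hδ₀' 3
  have hMδ : 10 * P.δ 3 < π / 2 := by
    have hπ := Real.pi_gt_three
    have h2 := hδ.2
    norm_num at h2
    linarith
  have hN : ((P.N 3 : ℕ) : ℝ) = 8 := by rw [K1Ledger.N_cast_eq P hN₀ hρN]; norm_num
  have h := lowFibre_hstep_ctg_le P hγ hδ₀ hd hN₀ hρN a b has h0 hb hab 3 120000 24000 (by norm_num) 18 12000 15000 (by norm_num) (by norm_num) (by norm_num)
    (po := 8) (by norm_num) (εg := 1 / 50) (by norm_num) hMδ hδ.2 (u' := 1) (v' := 4) (by norm_num)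
    (A := (18678971 / 10 ^ 10 : ℝ)) (βs := (59916201 / 10 ^ 12 : ℝ)) (ρs := (4544 / 10 ^ 25 : ℝ)) (Z := (1247 / 10 ^ 31 : ℝ)) (by norm_num) (by norm_num)
    (by simp only [hN, Finset.sum_range_succ, Finset.sum_range_zero]; norm_num)
    (by intro m hm; simp only [hN]; simp only [Finset.mem_range] at hm; interval_cases m <;> norm_num)
    (by rw [hN]; norm_num) (by simp only [Finset.sum_range_succ, Finset.sum_range_zero]; norm_num)
  have hw : Real.sqrt ((18678971 / 10 ^ 10 : ℝ) / π ^ 2 + (59916201 / 10 ^ 12 : ℝ) / π ^ 2 / 2) + Real.sqrt ((4544 / 10 ^ 25 : ℝ) / 2 + (1247 / 10 ^ 31 : ℝ)) ≤ (13866978 / 10 ^ 9 : ℝ) + (1609 / 10 ^ 14 : ℝ) := by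
    refine sqrt_add_sqrt_le_of_sq ?_ ?_ (by norm_num) (by norm_num)
    · exact div_pi_sq_add_le (by norm_num) (by norm_num) (by norm_num)
    · norm_num
  have hf : ((1 + P.γ) ^ (2 * 3) / ((24000 * 2 ^ 18 : ℕ) : ℝ)) ^ 2 ≤ (1 / 10 ^ 4) ^ 2 :=
    far_sq_le P hγ (t := 3) (X := 24000 * 2 ^ 18) (by norm_num) (by norm_num)
  have hF := Real.sqrt_nonneg (∑' k : Fin 2 → ℤ, (if ((24000 : ℕ) : ℤ) ≤ |k 0| ∧ (((1 : ℕ)) : ℤ) * |k 0| ≤ (((4 : ℕ)) : ℤ) * |k 1| then (1 : ℝ) else 0) * ‖mFourierCoeff (fun x => (a 3 x : ℂ)) k‖ ^ 2)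
  have hw0 : 0 ≤ Real.sqrt ((18678971 / 10 ^ 10 : ℝ) / π ^ 2 + (59916201 / 10 ^ 12 : ℝ) / π ^ 2 / 2) + Real.sqrt ((4544 / 10 ^ 25 : ℝ) / 2 + (1247 / 10 ^ 31 : ℝ)) := add_nonneg (Real.sqrt_nonneg _) (Real.sqrt_nonneg _)
  have hsq := pow_le_pow_left₀ (add_nonneg hw0 hF) (add_le_add hw (le_refl (Real.sqrt (∑' k : Fin 2 → ℤ, (if ((24000 : ℕ) : ℤ) ≤ |k 0| ∧ (((1 : ℕ)) : ℤ) * |k 0| ≤ (((4 : ℕ)) : ℤ) * |k 1| then (1 : ℝ) else 0) * ‖mFourierCoeff (fun x => (a 3 x : ℂ)) k‖ ^ 2)))) 2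
  linarith

set_option maxHeartbeats 4000000 in
/-- **(S-V) AT PHASE 3 AGAINST DECIMALS** (CT-GEO): `S_4(500000) ≤ T_3(120000) + (W_S + √C_3(41667))² + 10⁻⁸`, dyadic blocks from `Λ₀ = 120000` (`ℓ = 80000`, `r = 80000`, `M_b = 22`, `ε_g = 1 / 50`). [cite: Grafakos2014, Prop. 3.1.2 (5), Prop. 3.2.7 (3)] -/
theorem phase3_SV_ctg_le (hγ : P.γ = 8) (hδ₀ : 0 < P.δ₀) (hd : P.d = 2) (hN₀ : P.N₀ = 1) (hρN : P.ρN = 2)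
    (a b : ℕ → UnitAddTorus (Fin 2) → ℝ) (has : ∀ j, IsSmooth (a j)) (h0 : a 0 = datum)
    (hb : ∀ j, b j = a j ∘ shearMap 0 1 (amp ⟨P.U j, P.U_periodic j, P.contDiff_U (P.δ_pos hδ₀ (by rw [hd]; norm_num) j)⟩ P.γ))
    (hab : ∀ j, a (j + 1) = b j ∘ shearMap 1 0 (amp ⟨P.U j, P.U_periodic j, P.contDiff_U (P.δ_pos hδ₀ (by rw [hd]; norm_num) j)⟩ P.γ))
    (hδ₀' : P.δ₀ ≤ (2 : ℝ)⁻¹ ^ 100) :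
    ∑' k : Fin 2 → ℤ, (if |k 0| < ((500000 : ℕ) : ℤ) then (1 : ℝ) else 0) * ‖mFourierCoeff (fun x => (a (3 + 1) x : ℂ)) k‖ ^ 2 ≤
      ∑' k : Fin 2 → ℤ, (if |k 1| < ((120000 : ℕ) : ℤ) then (1 : ℝ) else 0) * ‖mFourierCoeff (fun x => (b 3 x : ℂ)) k‖ ^ 2 +
      (((56416882 / 10 ^ 10 : ℝ) + (1209 / 10 ^ 12 : ℝ) + Real.sqrt (∑' k : Fin 2 → ℤ, (if ((41667 : ℕ) : ℤ) ≤ |k 0| ∧ (((1 : ℕ)) : ℤ) * |k 1| ≤ (((3 : ℕ)) : ℤ) * |k 0| then (1 : ℝ) else 0) * ‖mFourierCoeff (fun x => (b 3 x : ℂ)) k‖ ^ 2)) ^ 2 + (1 / 10 ^ 4) ^ 2) := by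
  have hδ := P.delta_le_of_le hd hδ₀.le hδ₀' 3
  have hMδ : 10 * P.δ 3 < π / 2 := by
    have hπ := Real.pi_gt_three
    have h2 := hδ.2
    norm_num at h2
    linarith
  have hN : ((P.N 3 : ℕ) : ℝ) = 8 := by rw [K1Ledger.N_cast_eq P hN₀ hρN]; norm_num
  have h := strip_vstep_ctg_le P hγ hδ₀ hd hN₀ hρN a b has h0 hb hab 3 500000 120000 (by norm_num) 22 80000 80000 (by norm_num) (by norm_num) (by norm_num)
    (po := 8) (by norm_num) (εg := 1 / 50) (by norm_num) hMδ hδ.2 (u' := 1) (v' := 3) (by norm_num) (Y := 41667) (by norm_num)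
    (A := (30647859 / 10 ^ 11 : ℝ)) (βs := (15314693 / 10 ^ 12 : ℝ)) (ρs := (2909 / 10 ^ 21 : ℝ)) (Z := (1758 / 10 ^ 31 : ℝ)) (by norm_num) (by norm_num)
    (by simp only [hN, Finset.sum_range_succ, Finset.sum_range_zero]; norm_num)
    (by intro m hm; simp only [hN]; simp only [Finset.mem_range] at hm; interval_cases m <;> norm_num)
    (by rw [hN]; norm_num) (by simp only [Finset.sum_range_succ, Finset.sum_range_zero]; norm_num)
  have hw : Real.sqrt ((30647859 / 10 ^ 11 : ℝ) / π ^ 2 + (15314693 / 10 ^ 12 : ℝ) / π ^ 2 / 2) + Real.sqrt ((2909 / 10 ^ 21 : ℝ) / 2 + (1758 / 10 ^ 31 : ℝ)) ≤ (56416882 / 10 ^ 10 : ℝ) + (1209 / 10 ^ 12 : ℝ) := by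
    refine sqrt_add_sqrt_le_of_sq ?_ ?_ (by norm_num) (by norm_num)
    · exact div_pi_sq_add_le (by norm_num) (by norm_num) (by norm_num)
    · norm_num
  have hf : ((1 + P.γ) ^ (2 * 4) / ((120000 * 2 ^ 22 : ℕ) : ℝ)) ^ 2 ≤ (1 / 10 ^ 4) ^ 2 :=
    far_sq_le P hγ (t := 4) (X := 120000 * 2 ^ 22) (by norm_num) (by norm_num)
  have hF := Real.sqrt_nonneg (∑' k : Fin 2 → ℤ, (if ((41667 : ℕ) : ℤ) ≤ |k 0| ∧ (((1 : ℕ)) : ℤ) * |k 1| ≤ (((3 : ℕ)) : ℤ) * |k 0| then (1 : ℝ) else 0) * ‖mFourierCoeff (fun x => (b 3 x : ℂ)) k‖ ^ 2)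
  have hw0 : 0 ≤ Real.sqrt ((30647859 / 10 ^ 11 : ℝ) / π ^ 2 + (15314693 / 10 ^ 12 : ℝ) / π ^ 2 / 2) + Real.sqrt ((2909 / 10 ^ 21 : ℝ) / 2 + (1758 / 10 ^ 31 : ℝ)) := add_nonneg (Real.sqrt_nonneg _) (Real.sqrt_nonneg _)
  have hsq := pow_le_pow_left₀ (add_nonneg hw0 hF) (add_le_add hw (le_refl (Real.sqrt (∑' k : Fin 2 → ℤ, (if ((41667 : ℕ) : ℤ) ≤ |k 0| ∧ (((1 : ℕ)) : ℤ) * |k 1| ≤ (((3 : ℕ)) : ℤ) * |k 0| then (1 : ℝ) else 0) * ‖mFourierCoeff (fun x => (b 3 x : ℂ)) k‖ ^ 2)))) 2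
  linarith

set_option maxHeartbeats 4000000 in
/-- **(O-V) AT PHASE 3 AGAINST DECIMALS** (CT-GEO): `O_4(500000) ≤ (W_O + √C_3(41667))² + 10⁻⁸`, blocks `⌊125000·(3/2)^m⌋`, support `⌊41Λ_m/48⌋`, plateau `⌊Λ_{m+1}/3⌋`, box window `4Λ_{m+1}` (`M_b = 38`, `ε_g = 1 / 20`). [cite: Grafakos2014, Prop. 3.1.2 (5), Prop. 3.2.7 (3)] -/
theorem phase3_OV_ctg_le (hγ : P.γ = 8) (hδ₀ : 0 < P.δ₀) (hd : P.d = 2) (hN₀ : P.N₀ = 1) (hρN : P.ρN = 2)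
    (a b : ℕ → UnitAddTorus (Fin 2) → ℝ) (has : ∀ j, IsSmooth (a j)) (h0 : a 0 = datum)
    (hb : ∀ j, b j = a j ∘ shearMap 0 1 (amp ⟨P.U j, P.U_periodic j, P.contDiff_U (P.δ_pos hδ₀ (by rw [hd]; norm_num) j)⟩ P.γ))
    (hab : ∀ j, a (j + 1) = b j ∘ shearMap 1 0 (amp ⟨P.U j, P.U_periodic j, P.contDiff_U (P.δ_pos hδ₀ (by rw [hd]; norm_num) j)⟩ P.γ))
    (hδ₀' : P.δ₀ ≤ (2 : ℝ)⁻¹ ^ 100) :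
    ∑' k : Fin 2 → ℤ, (if ((500000 : ℕ) : ℤ) ≤ |k 0| ∧ (((1 : ℕ)) : ℤ) * |k 0| ≤ (((4 : ℕ)) : ℤ) * |k 1| then (1 : ℝ) else 0) * ‖mFourierCoeff (fun x => (a (3 + 1) x : ℂ)) k‖ ^ 2 ≤
      ((16200379 / 10 ^ 9 : ℝ) + (1475 / 10 ^ 12 : ℝ) + Real.sqrt (∑' k : Fin 2 → ℤ, (if ((41667 : ℕ) : ℤ) ≤ |k 0| ∧ (((1 : ℕ)) : ℤ) * |k 1| ≤ (((3 : ℕ)) : ℤ) * |k 0| then (1 : ℝ) else 0) * ‖mFourierCoeff (fun x => (b 3 x : ℂ)) k‖ ^ 2)) ^ 2 + (1 / 10 ^ 4) ^ 2 := by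
  have hδ := P.delta_le_of_le hd hδ₀.le hδ₀' 3
  have hMδ : 10 * P.δ 3 < π / 2 := by
    have hπ := Real.pi_gt_three
    have h2 := hδ.2
    norm_num at h2
    linarith
  have hN : ((P.N 3 : ℕ) : ℝ) = 8 := by rw [K1Ledger.N_cast_eq P hN₀ hρN]; norm_num
  have h := ratio_vstep_ctg_le P hγ hδ₀ hd hN₀ hρN a b has h0 hb hab 3 (v := 4) (X := 500000) (by norm_num) (ra := 3) (rb := 2) (qn := 41) (qd := 48) 125000
    (by norm_num) (by norm_num) (by norm_num) 38 (by norm_num) (by norm_num) (u' := 1) (v' := 3) (by norm_num) (by norm_num)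
    (by norm_num) (by norm_num) (by norm_num) (by norm_num) (po := 8) (by norm_num) (εg := 1 / 20) (by norm_num) hMδ hδ.2 (Y := 41667) (by norm_num)
    (A := (24563837 / 10 ^ 10 : ℝ)) (βs := (26782934 / 10 ^ 11 : ℝ)) (ρs := (4332 / 10 ^ 21 : ℝ)) (Z := (3869 / 10 ^ 31 : ℝ)) (by norm_num) (by norm_num)
    (by simp only [hN, Finset.sum_range_succ, Finset.sum_range_zero]; norm_num)
    (by intro m hm; simp only [hN]; simp only [Finset.mem_range] at hm; interval_cases m <;> norm_num)
    (by rw [hN]; norm_num) (by simp only [Finset.sum_range_succ, Finset.sum_range_zero]; norm_num)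
  have hw : Real.sqrt ((24563837 / 10 ^ 10 : ℝ) / π ^ 2 + (26782934 / 10 ^ 11 : ℝ) / π ^ 2 / 2) + Real.sqrt ((4332 / 10 ^ 21 : ℝ) / 2 + (3869 / 10 ^ 31 : ℝ)) ≤ (16200379 / 10 ^ 9 : ℝ) + (1475 / 10 ^ 12 : ℝ) := by
    refine sqrt_add_sqrt_le_of_sq ?_ ?_ (by norm_num) (by norm_num)
    · exact div_pi_sq_add_le (by norm_num) (by norm_num) (by norm_num)
    · norm_num
  have hf : ((1 + P.γ) ^ (2 * 4) / ((125000 * 3 ^ 38 / 2 ^ 38 : ℕ) : ℝ)) ^ 2 ≤ (1 / 10 ^ 4) ^ 2 :=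
    far_sq_le P hγ (t := 4) (X := 125000 * 3 ^ 38 / 2 ^ 38) (by norm_num) (by norm_num)
  have hF := Real.sqrt_nonneg (∑' k : Fin 2 → ℤ, (if ((41667 : ℕ) : ℤ) ≤ |k 0| ∧ (((1 : ℕ)) : ℤ) * |k 1| ≤ (((3 : ℕ)) : ℤ) * |k 0| then (1 : ℝ) else 0) * ‖mFourierCoeff (fun x => (b 3 x : ℂ)) k‖ ^ 2)
  have hw0 : 0 ≤ Real.sqrt ((24563837 / 10 ^ 10 : ℝ) / π ^ 2 + (26782934 / 10 ^ 11 : ℝ) / π ^ 2 / 2) + Real.sqrt ((4332 / 10 ^ 21 : ℝ) / 2 + (3869 / 10 ^ 31 : ℝ)) := add_nonneg (Real.sqrt_nonneg _) (Real.sqrt_nonneg _)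
  have hsq := pow_le_pow_left₀ (add_nonneg hw0 hF) (add_le_add hw (le_refl (Real.sqrt (∑' k : Fin 2 → ℤ, (if ((41667 : ℕ) : ℤ) ≤ |k 0| ∧ (((1 : ℕ)) : ℤ) * |k 1| ≤ (((3 : ℕ)) : ℤ) * |k 0| then (1 : ℝ) else 0) * ‖mFourierCoeff (fun x => (b 3 x : ℂ)) k‖ ^ 2)))) 2
  linarith

set_option maxHeartbeats 4000000 in
/-- **(C-H) AT PHASE 3 AGAINST DECIMALS** (CT-GEO): `C_3(41667) ≤ (W_C + √O_3(41667))² + 10⁻⁸` — the feed cone is the OFF-CONE set above `Y ≥ K_3 = 24000`, so its cap is `o_3` (no shell chain); blocks `⌊41667·(3/2)^m⌋`, support `⌊117Λ_m/96⌋`, plateau `⌊Λ_{m+1}/4⌋`, box window `3Λ_{m+1}` (`M_b = 30`, `ε_g = 1 / 20`). [cite: Grafakos2014, Prop. 3.1.2 (5), Prop. 3.2.7 (3)] -/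
theorem phase3_CH_ctg_le (hγ : P.γ = 8) (hδ₀ : 0 < P.δ₀) (hd : P.d = 2) (hN₀ : P.N₀ = 1) (hρN : P.ρN = 2)
    (a b : ℕ → UnitAddTorus (Fin 2) → ℝ) (has : ∀ j, IsSmooth (a j)) (h0 : a 0 = datum)
    (hb : ∀ j, b j = a j ∘ shearMap 0 1 (amp ⟨P.U j, P.U_periodic j, P.contDiff_U (P.δ_pos hδ₀ (by rw [hd]; norm_num) j)⟩ P.γ))
    (hab : ∀ j, a (j + 1) = b j ∘ shearMap 1 0 (amp ⟨P.U j, P.U_periodic j, P.contDiff_U (P.δ_pos hδ₀ (by rw [hd]; norm_num) j)⟩ P.γ))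
    (hδ₀' : P.δ₀ ≤ (2 : ℝ)⁻¹ ^ 100) :
    ∑' k : Fin 2 → ℤ, (if ((41667 : ℕ) : ℤ) ≤ |k 0| ∧ (((1 : ℕ)) : ℤ) * |k 1| ≤ (((3 : ℕ)) : ℤ) * |k 0| then (1 : ℝ) else 0) * ‖mFourierCoeff (fun x => (b 3 x : ℂ)) k‖ ^ 2 ≤
      ((12737582 / 10 ^ 9 : ℝ) + (2017 / 10 ^ 14 : ℝ) + Real.sqrt (∑' k : Fin 2 → ℤ, (if ((41667 : ℕ) : ℤ) ≤ |k 0| ∧ (((1 : ℕ)) : ℤ) * |k 0| ≤ (((4 : ℕ)) : ℤ) * |k 1| then (1 : ℝ) else 0) * ‖mFourierCoeff (fun x => (a 3 x : ℂ)) k‖ ^ 2)) ^ 2 + (1 / 10 ^ 4) ^ 2 := by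
  have hδ := P.delta_le_of_le hd hδ₀.le hδ₀' 3
  have hMδ : 10 * P.δ 3 < π / 2 := by
    have hπ := Real.pi_gt_three
    have h2 := hδ.2
    norm_num at h2
    linarith
  have hN : ((P.N 3 : ℕ) : ℝ) = 8 := by rw [K1Ledger.N_cast_eq P hN₀ hρN]; norm_num
  have h := ratio_hstep_ctg_le P hγ hδ₀ hd hN₀ hρN a b has h0 hb hab 3 (v := 3) (by norm_num) (ra := 3) (rb := 2) (qn := 117) (qd := 96) 41667
    (by norm_num) (by norm_num) (by norm_num) 30 (by norm_num) (u' := 1) (v' := 4) (by norm_num) (by norm_num)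
    (by norm_num) (by norm_num) (by norm_num) (by norm_num) (po := 8) (by norm_num) (εg := 1 / 20) (by norm_num) hMδ hδ.2 (Y := 41667) le_rfl
    (A := (15980853 / 10 ^ 10 : ℝ)) (βs := (64347737 / 10 ^ 13 : ℝ)) (ρs := (7328 / 10 ^ 25 : ℝ)) (Z := (1509 / 10 ^ 31 : ℝ)) (by norm_num) (by norm_num)
    (by simp only [hN, Finset.sum_range_succ, Finset.sum_range_zero]; norm_num)
    (by intro m hm; simp only [hN]; simp only [Finset.mem_range] at hm; interval_cases m <;> norm_num)
    (by rw [hN]; norm_num) (by simp only [Finset.sum_range_succ, Finset.sum_range_zero]; norm_num)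
  have hw : Real.sqrt ((15980853 / 10 ^ 10 : ℝ) / π ^ 2 + (64347737 / 10 ^ 13 : ℝ) / π ^ 2 / 2) + Real.sqrt ((7328 / 10 ^ 25 : ℝ) / 2 + (1509 / 10 ^ 31 : ℝ)) ≤ (12737582 / 10 ^ 9 : ℝ) + (2017 / 10 ^ 14 : ℝ) := by
    refine sqrt_add_sqrt_le_of_sq ?_ ?_ (by norm_num) (by norm_num)
    · exact div_pi_sq_add_le (by norm_num) (by norm_num) (by norm_num)
    · norm_num
  have hf : ((1 + P.γ) ^ (2 * 3) / ((41667 * 3 ^ 30 / 2 ^ 30 : ℕ) : ℝ)) ^ 2 ≤ (1 / 10 ^ 4) ^ 2 :=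
    far_sq_le P hγ (t := 3) (X := 41667 * 3 ^ 30 / 2 ^ 30) (by norm_num) (by norm_num)
  have hF := Real.sqrt_nonneg (∑' k : Fin 2 → ℤ, (if ((41667 : ℕ) : ℤ) ≤ |k 0| ∧ (((1 : ℕ)) : ℤ) * |k 0| ≤ (((4 : ℕ)) : ℤ) * |k 1| then (1 : ℝ) else 0) * ‖mFourierCoeff (fun x => (a 3 x : ℂ)) k‖ ^ 2)
  have hw0 : 0 ≤ Real.sqrt ((15980853 / 10 ^ 10 : ℝ) / π ^ 2 + (64347737 / 10 ^ 13 : ℝ) / π ^ 2 / 2) + Real.sqrt ((7328 / 10 ^ 25 : ℝ) / 2 + (1509 / 10 ^ 31 : ℝ)) := add_nonneg (Real.sqrt_nonneg _) (Real.sqrt_nonneg _)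
  have hsq := pow_le_pow_left₀ (add_nonneg hw0 hF) (add_le_add hw (le_refl (Real.sqrt (∑' k : Fin 2 → ℤ, (if ((41667 : ℕ) : ℤ) ≤ |k 0| ∧ (((1 : ℕ)) : ℤ) * |k 0| ≤ (((4 : ℕ)) : ℤ) * |k 1| then (1 : ℝ) else 0) * ‖mFourierCoeff (fun x => (a 3 x : ℂ)) k‖ ^ 2)))) 2
  linarith

/-! ## §2 The phase-3 step and the next off-cone amplitude -/

set_option maxHeartbeats 800000 in
/-- **PHASE 3 OF THE K1loc′ LEDGER IN CT-GEO GRADE, AGAINST DECIMALS** (`…LedgerFeedChain.strip_offCone_resolved_step` on the four windows above, both feed caps `= o ≥ √O_3(24000)` by `sqrt_offCone_le_of_le`): `S_4(500000) + O_4(500000) ≤ S_3(24000) + O_3(24000) + e_3(o)`. [cite: Grafakos2014, Prop. 3.1.2 (5), Prop. 3.2.7 (3)] -/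
theorem phase3_step_ctg_le (hγ : P.γ = 8) (hδ₀ : 0 < P.δ₀) (hd : P.d = 2) (hN₀ : P.N₀ = 1) (hρN : P.ρN = 2)
    (a b : ℕ → UnitAddTorus (Fin 2) → ℝ) (has : ∀ j, IsSmooth (a j)) (h0 : a 0 = datum)
    (hb : ∀ j, b j = a j ∘ shearMap 0 1 (amp ⟨P.U j, P.U_periodic j, P.contDiff_U (P.δ_pos hδ₀ (by rw [hd]; norm_num) j)⟩ P.γ))
    (hab : ∀ j, a (j + 1) = b j ∘ shearMap 1 0 (amp ⟨P.U j, P.U_periodic j, P.contDiff_U (P.δ_pos hδ₀ (by rw [hd]; norm_num) j)⟩ P.γ))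
    (hδ₀' : P.δ₀ ≤ (2 : ℝ)⁻¹ ^ 100)
    {o : ℝ} (ho : Real.sqrt (∑' k : Fin 2 → ℤ, (if ((24000 : ℕ) : ℤ) ≤ |k 0| ∧ (((1 : ℕ)) : ℤ) * |k 0| ≤ (((4 : ℕ)) : ℤ) * |k 1| then (1 : ℝ) else 0) * ‖mFourierCoeff (fun x => (a 3 x : ℂ)) k‖ ^ 2) ≤ o) :
    ∑' k : Fin 2 → ℤ, (if |k 0| < ((500000 : ℕ) : ℤ) then (1 : ℝ) else 0) * ‖mFourierCoeff (fun x => (a (3 + 1) x : ℂ)) k‖ ^ 2 +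
      ∑' k : Fin 2 → ℤ, (if ((500000 : ℕ) : ℤ) ≤ |k 0| ∧ (((1 : ℕ)) : ℤ) * |k 0| ≤ (((4 : ℕ)) : ℤ) * |k 1| then (1 : ℝ) else 0) * ‖mFourierCoeff (fun x => (a (3 + 1) x : ℂ)) k‖ ^ 2 ≤
      ∑' k : Fin 2 → ℤ, (if |k 0| < ((24000 : ℕ) : ℤ) then (1 : ℝ) else 0) * ‖mFourierCoeff (fun x => (a 3 x : ℂ)) k‖ ^ 2 +
      ∑' k : Fin 2 → ℤ, (if ((24000 : ℕ) : ℤ) ≤ |k 0| ∧ (((1 : ℕ)) : ℤ) * |k 0| ≤ (((4 : ℕ)) : ℤ) * |k 1| then (1 : ℝ) else 0) * ‖mFourierCoeff (fun x => (a 3 x : ℂ)) k‖ ^ 2 +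
      (((13866978 / 10 ^ 9 : ℝ) + (1609 / 10 ^ 14 : ℝ)) ^ 2 + 2 * ((13866978 / 10 ^ 9 : ℝ) + (1609 / 10 ^ 14 : ℝ)) * o + (((56416882 / 10 ^ 10 : ℝ) + (1209 / 10 ^ 12 : ℝ)) + ((12737582 / 10 ^ 9 : ℝ) + (2017 / 10 ^ 14 : ℝ)) + o + 1 / 10 ^ 4) ^ 2 + (((16200379 / 10 ^ 9 : ℝ) + (1475 / 10 ^ 12 : ℝ)) + ((12737582 / 10 ^ 9 : ℝ) + (2017 / 10 ^ 14 : ℝ)) + o + 1 / 10 ^ 4) ^ 2 +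
        (1 / 10 ^ 4) ^ 2 + (1 / 10 ^ 4) ^ 2 + (1 / 10 ^ 4) ^ 2) := by
  have h1 := phase3_SV_ctg_le P hγ hδ₀ hd hN₀ hρN a b has h0 hb hab hδ₀'
  have h2 := phase3_TH_ctg_le P hγ hδ₀ hd hN₀ hρN a b has h0 hb hab hδ₀'
  have h3 := phase3_OV_ctg_le P hγ hδ₀ hd hN₀ hρN a b has h0 hb hab hδ₀'
  have h4 := phase3_CH_ctg_le P hγ hδ₀ hd hN₀ hρN a b has h0 hb hab hδ₀'
  have h𝔞 := sqrt_offCone_le_of_le has 3 (K := 24000) (Y := 41667) (by norm_num) ho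
  have hI0 : ∀ (q : (Fin 2 → ℤ) → Prop) [DecidablePred q] (v : UnitAddTorus (Fin 2) → ℝ),
      0 ≤ ∑' k : Fin 2 → ℤ, (if q k then (1 : ℝ) else 0) * ‖mFourierCoeff (fun x => (v x : ℂ)) k‖ ^ 2 :=
    fun q _ v => tsum_nonneg fun k => mul_nonneg (by split_ifs <;> norm_num) (sq_nonneg _)
  have h1' := h1.trans (add_assoc _ _ _).symm.le
  have h2' := h2.trans (add_assoc _ _ _).symm.le
  have hres := strip_offCone_resolved_step h1' h2' h3 h4 h4 h𝔞 h𝔞 ho (hI0 _ _) (hI0 _ _) (hI0 _ _) (by norm_num) (by norm_num)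
    (by norm_num) (by norm_num) (by norm_num) (by norm_num) (by norm_num)
  rw [Real.sqrt_sq (by norm_num : (0 : ℝ) ≤ 1 / 10 ^ 4)] at hres
  exact hres

set_option maxHeartbeats 800000 in
/-- **THE NEXT OFF-CONE AMPLITUDE AT PHASE 3** (`…LedgerFeedChain.sqrt_offCone_next_le`): `√O_4(500000) ≤ W_O + W_C + o + 2·10⁻⁴`. [cite: Grafakos2014, Prop. 3.2.7 (3)] -/
theorem phase3_offCone_next_ctg_le (hγ : P.γ = 8) (hδ₀ : 0 < P.δ₀) (hd : P.d = 2) (hN₀ : P.N₀ = 1) (hρN : P.ρN = 2)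
    (a b : ℕ → UnitAddTorus (Fin 2) → ℝ) (has : ∀ j, IsSmooth (a j)) (h0 : a 0 = datum)
    (hb : ∀ j, b j = a j ∘ shearMap 0 1 (amp ⟨P.U j, P.U_periodic j, P.contDiff_U (P.δ_pos hδ₀ (by rw [hd]; norm_num) j)⟩ P.γ))
    (hab : ∀ j, a (j + 1) = b j ∘ shearMap 1 0 (amp ⟨P.U j, P.U_periodic j, P.contDiff_U (P.δ_pos hδ₀ (by rw [hd]; norm_num) j)⟩ P.γ))
    (hδ₀' : P.δ₀ ≤ (2 : ℝ)⁻¹ ^ 100)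
    {o : ℝ} (ho : Real.sqrt (∑' k : Fin 2 → ℤ, (if ((24000 : ℕ) : ℤ) ≤ |k 0| ∧ (((1 : ℕ)) : ℤ) * |k 0| ≤ (((4 : ℕ)) : ℤ) * |k 1| then (1 : ℝ) else 0) * ‖mFourierCoeff (fun x => (a 3 x : ℂ)) k‖ ^ 2) ≤ o) :
    Real.sqrt (∑' k : Fin 2 → ℤ, (if ((500000 : ℕ) : ℤ) ≤ |k 0| ∧ (((1 : ℕ)) : ℤ) * |k 0| ≤ (((4 : ℕ)) : ℤ) * |k 1| then (1 : ℝ) else 0) * ‖mFourierCoeff (fun x => (a (3 + 1) x : ℂ)) k‖ ^ 2) ≤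
      ((16200379 / 10 ^ 9 : ℝ) + (1475 / 10 ^ 12 : ℝ)) + ((12737582 / 10 ^ 9 : ℝ) + (2017 / 10 ^ 14 : ℝ)) + o + 1 / 10 ^ 4 + 1 / 10 ^ 4 := by
  have h3 := phase3_OV_ctg_le P hγ hδ₀ hd hN₀ hρN a b has h0 hb hab hδ₀'
  have h5 := phase3_CH_ctg_le P hγ hδ₀ hd hN₀ hρN a b has h0 hb hab hδ₀'
  have h𝔞 := sqrt_offCone_le_of_le has 3 (K := 24000) (Y := 41667) (by norm_num) ho
  have hI0 : ∀ (q : (Fin 2 → ℤ) → Prop) [DecidablePred q] (v : UnitAddTorus (Fin 2) → ℝ),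
      0 ≤ ∑' k : Fin 2 → ℤ, (if q k then (1 : ℝ) else 0) * ‖mFourierCoeff (fun x => (v x : ℂ)) k‖ ^ 2 :=
    fun q _ v => tsum_nonneg fun k => mul_nonneg (by split_ifs <;> norm_num) (sq_nonneg _)
  have hres := sqrt_offCone_next_le h3 h5 h𝔞 (hI0 _ _) (by norm_num) (by norm_num) (by norm_num) (by norm_num)
  rw [Real.sqrt_sq (by norm_num : (0 : ℝ) ≤ 1 / 10 ^ 4)] at hres
  exact hres

/-! ## §3 The closer from the phase-2 entry data -/

set_option maxHeartbeats 800000 in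
/-- **THE K1loc′ CHAIN FROM THE PHASE-2 ENTRY DATA** (this file's header, §3): `S₂(800) + O₂(800) ≤ E₂`, `√O₂(800) ≤ o₂`, `δ₀ ≤ 2⁻¹⁰⁰` and the polynomial budget `E₂ + e₂(o₂) + e₃(o₃(o₂)) + 0.2424·o₄(o₂) ≤ 0.364` give `K1Localised P (γ² − 3)`. [cite: DEIJ2022, (1.2)–(1.3)] [cite: Grafakos2014, Prop. 3.2.7 (3)] -/
theorem k1Localised_of_phase2_ctg (hγ : P.γ = 8) (hδ₀ : 0 < P.δ₀) (hd : P.d = 2) (hN₀ : P.N₀ = 1) (hρN : P.ρN = 2)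
    (a b : ℕ → UnitAddTorus (Fin 2) → ℝ) (has : ∀ j, IsSmooth (a j)) (h0 : a 0 = datum)
    (hb : ∀ j, b j = a j ∘ shearMap 0 1 (amp ⟨P.U j, P.U_periodic j, P.contDiff_U (P.δ_pos hδ₀ (by rw [hd]; norm_num) j)⟩ P.γ))
    (hab : ∀ j, a (j + 1) = b j ∘ shearMap 1 0 (amp ⟨P.U j, P.U_periodic j, P.contDiff_U (P.δ_pos hδ₀ (by rw [hd]; norm_num) j)⟩ P.γ))
    (hδ₀' : P.δ₀ ≤ (2 : ℝ)⁻¹ ^ 100)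
    {E₂ o₂ : ℝ}
    (hE₂ : ∑' k : Fin 2 → ℤ, (if |k 0| < ((800 : ℕ) : ℤ) then (1 : ℝ) else 0) * ‖mFourierCoeff (fun x => (a 2 x : ℂ)) k‖ ^ 2 +
      ∑' k : Fin 2 → ℤ, (if ((800 : ℕ) : ℤ) ≤ |k 0| ∧ (((1 : ℕ)) : ℤ) * |k 0| ≤ (((4 : ℕ)) : ℤ) * |k 1| then (1 : ℝ) else 0) * ‖mFourierCoeff (fun x => (a 2 x : ℂ)) k‖ ^ 2 ≤ E₂)
    (ho₂ : Real.sqrt (∑' k : Fin 2 → ℤ, (if ((800 : ℕ) : ℤ) ≤ |k 0| ∧ (((1 : ℕ)) : ℤ) * |k 0| ≤ (((4 : ℕ)) : ℤ) * |k 1| then (1 : ℝ) else 0) * ‖mFourierCoeff (fun x => (a 2 x : ℂ)) k‖ ^ 2) ≤ o₂)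
    (hbudget : E₂ + (((63631098 / 10 ^ 9 : ℝ) + (1504 / 10 ^ 15 : ℝ)) ^ 2 + 2 * ((63631098 / 10 ^ 9 : ℝ) + (1504 / 10 ^ 15 : ℝ)) * o₂ + (((33040464 / 10 ^ 9 : ℝ) + (4526 / 10 ^ 14 : ℝ)) + ((41059393 / 10 ^ 9 : ℝ) + (1364 / 10 ^ 15 : ℝ)) + o₂ + 1 / 10 ^ 4) ^ 2 + (((49952058 / 10 ^ 9 : ℝ) + (2894 / 10 ^ 14 : ℝ)) + ((41059393 / 10 ^ 9 : ℝ) + (1364 / 10 ^ 15 : ℝ)) + o₂ + 1 / 10 ^ 4) ^ 2 +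
        (1 / 10 ^ 4) ^ 2 + (1 / 10 ^ 4) ^ 2 + (1 / 10 ^ 4) ^ 2) +
      (((13866978 / 10 ^ 9 : ℝ) + (1609 / 10 ^ 14 : ℝ)) ^ 2 + 2 * ((13866978 / 10 ^ 9 : ℝ) + (1609 / 10 ^ 14 : ℝ)) * (((49952058 / 10 ^ 9 : ℝ) + (2894 / 10 ^ 14 : ℝ)) + ((41059393 / 10 ^ 9 : ℝ) + (1364 / 10 ^ 15 : ℝ)) + o₂ + 1 / 10 ^ 4 + 1 / 10 ^ 4) + (((56416882 / 10 ^ 10 : ℝ) + (1209 / 10 ^ 12 : ℝ)) + ((12737582 / 10 ^ 9 : ℝ) + (2017 / 10 ^ 14 : ℝ)) + (((49952058 / 10 ^ 9 : ℝ) + (2894 / 10 ^ 14 : ℝ)) + ((41059393 / 10 ^ 9 : ℝ) + (1364 / 10 ^ 15 : ℝ)) + o₂ + 1 / 10 ^ 4 + 1 / 10 ^ 4) + 1 / 10 ^ 4) ^ 2 + (((16200379 / 10 ^ 9 : ℝ) + (1475 / 10 ^ 12 : ℝ)) + ((12737582 / 10 ^ 9 : ℝ) + (2017 / 10 ^ 14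 : ℝ)) + (((49952058 / 10 ^ 9 : ℝ) + (2894 / 10 ^ 14 : ℝ)) + ((41059393 / 10 ^ 9 : ℝ) + (1364 / 10 ^ 15 : ℝ)) + o₂ + 1 / 10 ^ 4 + 1 / 10 ^ 4) + 1 / 10 ^ 4) ^ 2 +
        (1 / 10 ^ 4) ^ 2 + (1 / 10 ^ 4) ^ 2 + (1 / 10 ^ 4) ^ 2) +
      0.2424 * (((16200379 / 10 ^ 9 : ℝ) + (1475 / 10 ^ 12 : ℝ)) + ((12737582 / 10 ^ 9 : ℝ) + (2017 / 10 ^ 14 : ℝ)) + (((49952058 / 10 ^ 9 : ℝ) + (2894 / 10 ^ 14 : ℝ)) + ((41059393 / 10 ^ 9 : ℝ) + (1364 / 10 ^ 15 : ℝ)) + o₂ + 1 / 10 ^ 4 + 1 / 10 ^ 4) + 1 / 10 ^ 4 + 1 / 10 ^ 4) ≤ 0.364) :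
    K1Localised P (P.γ ^ 2 - 3) := by
  have h2 := phase2_step_ctg_le P hγ hδ₀ hd hN₀ hρN a b has h0 hb hab hδ₀' ho₂
  have n2 := phase2_offCone_next_ctg_le P hγ hδ₀ hd hN₀ hρN a b has h0 hb hab hδ₀' ho₂
  have h3 := phase3_step_ctg_le P hγ hδ₀ hd hN₀ hρN a b has h0 hb hab hδ₀' n2
  have n3 := phase3_offCone_next_ctg_le P hγ hδ₀ hd hN₀ hρN a b has h0 hb hab hδ₀' n2
  have ho₄ : 0 ≤ ((16200379 / 10 ^ 9 : ℝ) + (1475 / 10 ^ 12 : ℝ)) + ((12737582 / 10 ^ 9 : ℝ) + (2017 / 10 ^ 14 : ℝ)) + (((49952058 / 10 ^ 9 : ℝ) + (2894 / 10 ^ 14 : ℝ)) + ((41059393 / 10 ^ 9 : ℝ) + (1364 / 10 ^ 15 : ℝ)) + o₂ + 1 / 10 ^ 4 + 1 / 10 ^ 4) + 1 / 10 ^ 4 + 1 / 10 ^ 4 := (Real.sqrt_nonneg _).trans n3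
  exact k1Localised_of_phase4_sharp P hγ hδ₀ hδ₀' hd hN₀ hρN a b has h0 hb hab ho₄
    (h3.trans (add_le_add (h2.trans (add_le_add hE₂ le_rfl)) le_rfl)) n3 (by linarith [hbudget])

set_option maxHeartbeats 800000 in
/-- **THE SAME AT `E₂ = 0.03`, `o₂ = 0.055`** (the budget evaluates to `≈ 0.19 ≤ 0.364`). [cite: DEIJ2022, (1.2)–(1.3)] [cite: Grafakos2014, Prop. 3.2.7 (3)] -/
theorem k1Localised_of_phase2_ctg_at (hγ : P.γ = 8) (hδ₀ : 0 < P.δ₀) (hd : P.d = 2) (hN₀ : P.N₀ = 1) (hρN : P.ρN = 2)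
    (a b : ℕ → UnitAddTorus (Fin 2) → ℝ) (has : ∀ j, IsSmooth (a j)) (h0 : a 0 = datum)
    (hb : ∀ j, b j = a j ∘ shearMap 0 1 (amp ⟨P.U j, P.U_periodic j, P.contDiff_U (P.δ_pos hδ₀ (by rw [hd]; norm_num) j)⟩ P.γ))
    (hab : ∀ j, a (j + 1) = b j ∘ shearMap 1 0 (amp ⟨P.U j, P.U_periodic j, P.contDiff_U (P.δ_pos hδ₀ (by rw [hd]; norm_num) j)⟩ P.γ))
    (hδ₀' : P.δ₀ ≤ (2 : ℝ)⁻¹ ^ 100)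
    (hE₂ : ∑' k : Fin 2 → ℤ, (if |k 0| < ((800 : ℕ) : ℤ) then (1 : ℝ) else 0) * ‖mFourierCoeff (fun x => (a 2 x : ℂ)) k‖ ^ 2 +
      ∑' k : Fin 2 → ℤ, (if ((800 : ℕ) : ℤ) ≤ |k 0| ∧ (((1 : ℕ)) : ℤ) * |k 0| ≤ (((4 : ℕ)) : ℤ) * |k 1| then (1 : ℝ) else 0) * ‖mFourierCoeff (fun x => (a 2 x : ℂ)) k‖ ^ 2 ≤ 3 / 100)
    (ho₂ : Real.sqrt (∑' k : Fin 2 → ℤ, (if ((800 : ℕ) : ℤ) ≤ |k 0| ∧ (((1 : ℕ)) : ℤ) * |k 0| ≤ (((4 : ℕ)) : ℤ) * |k 1| then (1 : ℝ) else 0) * ‖mFourierCoeff (fun x => (a 2 x : ℂ)) k‖ ^ 2) ≤ 11 / 200) :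
    K1Localised P (P.γ ^ 2 - 3) := by
  exact k1Localised_of_phase2_ctg P hγ hδ₀ hd hN₀ hρN a b has h0 hb hab hδ₀' hE₂ ho₂ (by norm_num)

end Cascade

end Summit.AnomalousDissipation.AnomalousDissipation.Theorems.SawtoothPulseCascade.K1Window
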